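import Literature.Analysis.FluidPDE.CylindricalGenerator
import Mathlib.Analysis.InnerProductSpace.PiL2
import Mathlib.Analysis.InnerProductSpace.Calculus
import Mathlib.Analysis.Calculus.FDeriv.Mul
import Mathlib.Analysis.Calculus.FDeriv.Prod
import HarnessLib

/-!
# Stub `stub_cutoffTest` of line `cutoff_compactness` (crux stmt-AnomalousDissipation-18402,
  `TameRoughRigidity.TameClosure`)

**The product cut-off test.** For a cylindrical test functional `Φ` on `H = L²_σ(T³)` (fields
`g₁, …, g_m`, profile `φ`), an order `K` and a level `ρ > 0`, the functional
`Ψ(v) = Φ(v) · χ(|P_K v|² / ρ)` (`χ = Torus.galerkinCutoff`, `|P_K v|² = Torus.truncNormSq K v`)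
is again cylindrical: its fields are `Φ.g` followed (`Fin.append`) by the Parseval frame
`(Torus.galerkinTest K hρ).g` of `P_K H`, and its profile is
`Π(z) = φ(z_head) · χ(|z_tail|² / ρ)`, head and tail being read off through Mathlib's
`EuclideanSpace.finAddEquivProd : ℝ^{m+D} ≃L ℝ^m × ℝ^D`. Its differential is, for EVERY `v ∈ H`,
`Ψ'(v) = χ(|P_K v|²/ρ) Φ'(v) + (2/ρ) χ'(|P_K v|²/ρ) Φ(v) P_K v`
(product and chain rule on the profile; `Σ_p (v, e_p)² = |P_K v|²` and `Σ_p (v, e_p) e_p = P_K v`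
for the frame, `Torus.norm_sq_galerkinTest_coords`, `Torus.sum_integral_inner_frameField_smul`;
the pattern is `Torus.grad_galerkinTest`). This is the Galerkin cut-off device of
Foias–Manley–Rosa–Temam (Ch. IV §1.2, p. 197, `Φ(u) = ρ(|P_m u|²)`) multiplied into an arbitrary
cylindrical test.

## References

* C. Foias, O. Manley, R. Rosa, R. Temam, *Navier–Stokes Equations and Turbulence* (CUP 2001),
  Ch. IV §1.2 (example after Def. 1.2, p. 197); App. B.1. [FoiasManleyRosaTemam2001]
-/

set_option linter.dupNamespace false

noncomputable section

namespace Summit.AnomalousDissipation.AnomalousDissipation.Theorems.TameRoughRigidity.TameClosure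

open MeasureTheory Filter Topology UnitAddTorus
open scoped InnerProductSpace RealInnerProductSpace ENNReal NNReal
open Literature.Analysis.FunctionSpaces Literature.Analysis.FluidPDE

/-- Local notation: real vector fields on `T³`. -/
local notation "Vec3" => (UnitAddTorus (Fin 3)) → (EuclideanSpace ℝ (Fin 3))
/-- Local notation: `L²(T³; ℝ³)`. -/
local notation "L2" => (Lp (EuclideanSpace ℝ (Fin 3)) 2 (volume : Measure (UnitAddTorus (Fin 3))))
/-- Local notation: the energy space `H`. -/
local notation "H3" => (Torus.energySpace (Fin 3))

/-! ### Head and tail coordinates of `ℝ^{n+D} ≃ ℝ^n × ℝ^D` -/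

/-- The head of a basis vector with a head index is the corresponding basis vector. [folklore] -/
private theorem cutoffTest_split_single_castAdd_fst (n D : ℕ) (i : Fin n) :
    (EuclideanSpace.finAddEquivProd (𝕜 := ℝ)
        (EuclideanSpace.single (Fin.castAdd D i) (1 : ℝ))).1 = EuclideanSpace.single i 1 := by
  ext i'
  simp [PiLp.single_apply]

/-- The tail of a basis vector with a head index vanishes. [folklore] -/
private theorem cutoffTest_split_single_castAdd_snd (n D : ℕ) (i : Fin n) :
    (EuclideanSpace.finAddEquivProd (𝕜 := ℝ)
        (EuclideanSpace.single (Fin.castAdd D i) (1 : ℝ))).2 = 0 := by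
  ext j
  simp [PiLp.single_apply]

/-- The head of a basis vector with a tail index vanishes. [folklore] -/
private theorem cutoffTest_split_single_natAdd_fst (n D : ℕ) (j : Fin D) :
    (EuclideanSpace.finAddEquivProd (𝕜 := ℝ)
        (EuclideanSpace.single (Fin.natAdd n j) (1 : ℝ))).1 = 0 := by
  ext i
  simp [PiLp.single_apply]

/-- The tail of a basis vector with a tail index is the corresponding basis vector. [folklore] -/
private theorem cutoffTest_split_single_natAdd_snd (n D : ℕ) (j : Fin D) :
    (EuclideanSpace.finAddEquivProd (𝕜 := ℝ)
        (EuclideanSpace.single (Fin.natAdd n j) (1 : ℝ))).2 = EuclideanSpace.single j 1 := by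
  ext j'
  simp [PiLp.single_apply]

/-! ### The product profile `Π(z) = φ(z_head) χ(|z_tail|²/ρ)` -/

/-- The product profile is `C¹`. [folklore] -/
private theorem cutoffTest_contDiff_profile {n D : ℕ} {φ : EuclideanSpace ℝ (Fin n) → ℝ}
    (hφ : ContDiff ℝ 1 φ) (ρ : ℝ) :
    ContDiff ℝ 1 (fun z : EuclideanSpace ℝ (Fin (n + D)) =>
      φ (EuclideanSpace.finAddEquivProd z).1 *
        (Torus.galerkinCutoff : ℝ → ℝ) (‖(EuclideanSpace.finAddEquivProd z).2‖ ^ 2 / ρ)) := by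
  have hE := (EuclideanSpace.finAddEquivProd (𝕜 := ℝ) (n := n) (m := D)).contDiff (n := 1)
  exact (hφ.comp hE.fst).mul ((Torus.galerkinCutoff.contDiff (n := 1)).comp
    (((contDiff_norm_sq ℝ).comp hE.snd).div_const ρ))

/-- The product profile has compact support (`ρ > 0`): it vanishes off the preimage of
`tsupport φ × closedBall 0 √(2ρ)`. [folklore] -/
private theorem cutoffTest_hasCompactSupport_profile {n D : ℕ} {φ : EuclideanSpace ℝ (Fin n) → ℝ}
    (hφ : HasCompactSupport φ) {ρ : ℝ} (hρ : 0 < ρ) :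
    HasCompactSupport (fun z : EuclideanSpace ℝ (Fin (n + D)) =>
      φ (EuclideanSpace.finAddEquivProd z).1 *
        (Torus.galerkinCutoff : ℝ → ℝ) (‖(EuclideanSpace.finAddEquivProd z).2‖ ^ 2 / ρ)) := by
  refine HasCompactSupport.intro
    (((EuclideanSpace.finAddEquivProd (𝕜 := ℝ) (n := n) (m := D)).toHomeomorph.isCompact_preimage).2
      (hφ.isCompact.prod
        (isCompact_closedBall (0 : EuclideanSpace ℝ (Fin D)) (Real.sqrt (2 * ρ))))) fun z hz => ?_
  rw [Set.mem_preimage, ContinuousLinearEquiv.coe_toHomeomorph, Set.mem_prod, not_and_or] at hz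
  rcases hz with h1 | h2
  · rw [image_eq_zero_of_notMem_tsupport h1, zero_mul]
  · rw [Metric.mem_closedBall, dist_zero_right, not_le] at h2
    have h3 : 2 * ρ < ‖(EuclideanSpace.finAddEquivProd z).2‖ ^ 2 :=
      (Real.sqrt_lt' ((Real.sqrt_nonneg _).trans_lt h2)).1 h2
    have h4 : Torus.galerkinCutoff.rOut ≤
        dist (‖(EuclideanSpace.finAddEquivProd z).2‖ ^ 2 / ρ) 0 := by
      rw [Real.dist_eq, sub_zero, abs_of_nonneg (by positivity)]
      show (2 : ℝ) ≤ ‖(EuclideanSpace.finAddEquivProd z).2‖ ^ 2 / ρ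
      rw [le_div_iff₀ hρ]
      linarith
    rw [Torus.galerkinCutoff.zero_of_le_dist h4, mul_zero]

/-- **Differential of the product profile**: for `z, e ∈ ℝ^{n+D}`,
`DΠ(z) e = Dφ(z_head) e_head · χ(|z_tail|²/ρ) + φ(z_head) · (2/ρ) χ'(|z_tail|²/ρ) ⟪z_tail, e_tail⟫`
(product rule and chain rule). [folklore] -/
private theorem cutoffTest_fderiv_profile {n D : ℕ} {φ : EuclideanSpace ℝ (Fin n) → ℝ}
    (hφ : ContDiff ℝ 1 φ) (ρ : ℝ) (z e : EuclideanSpace ℝ (Fin (n + D))) :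
    fderiv ℝ (fun z : EuclideanSpace ℝ (Fin (n + D)) =>
        φ (EuclideanSpace.finAddEquivProd z).1 *
          (Torus.galerkinCutoff : ℝ → ℝ) (‖(EuclideanSpace.finAddEquivProd z).2‖ ^ 2 / ρ)) z e =
      fderiv ℝ φ (EuclideanSpace.finAddEquivProd z).1 (EuclideanSpace.finAddEquivProd e).1 *
          (Torus.galerkinCutoff : ℝ → ℝ) (‖(EuclideanSpace.finAddEquivProd z).2‖ ^ 2 / ρ) +
        φ (EuclideanSpace.finAddEquivProd z).1 *
          (2 / ρ * deriv (Torus.galerkinCutoff : ℝ → ℝ)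
              (‖(EuclideanSpace.finAddEquivProd z).2‖ ^ 2 / ρ) *
            ⟪(EuclideanSpace.finAddEquivProd z).2, (EuclideanSpace.finAddEquivProd e).2⟫_ℝ) := by
  -- the head factor `φ(z_head)`
  have hA := ((hφ.differentiable one_ne_zero) (EuclideanSpace.finAddEquivProd z).1).hasFDerivAt.comp
    z (EuclideanSpace.finAddEquivProd (𝕜 := ℝ) (n := n) (m := D)).hasFDerivAt.fst
  -- the tail factor `χ(|z_tail|² / ρ)`
  have hχ : ∀ s : ℝ, HasDerivAt (fun s : ℝ => (Torus.galerkinCutoff : ℝ → ℝ) (s / ρ))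
      (deriv (Torus.galerkinCutoff : ℝ → ℝ) (s / ρ) * (1 / ρ)) s := fun s => by
    have h1 : HasDerivAt (Torus.galerkinCutoff : ℝ → ℝ)
        (deriv (Torus.galerkinCutoff : ℝ → ℝ) (s / ρ)) (s / ρ) :=
      (((Torus.galerkinCutoff.contDiff (n := 1)).differentiable (by simp)) _).hasDerivAt
    have h2 : HasDerivAt (fun s : ℝ => s / ρ) (1 / ρ) s := by
      simpa using (hasDerivAt_id s).div_const ρ
    have h3 := h1.comp s h2
    exact h3
  have hB := (hχ _).comp_hasFDerivAt z ((hasStrictFDerivAt_norm_sq _).hasFDerivAt.comp z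
    (EuclideanSpace.finAddEquivProd (𝕜 := ℝ) (n := n) (m := D)).hasFDerivAt.snd)
  have key : HasFDerivAt (fun z : EuclideanSpace ℝ (Fin (n + D)) =>
      φ (EuclideanSpace.finAddEquivProd z).1 *
        (Torus.galerkinCutoff : ℝ → ℝ) (‖(EuclideanSpace.finAddEquivProd z).2‖ ^ 2 / ρ)) _ z :=
    hA.mul hB
  rw [key.fderiv]
  simp only [_root_.add_apply, _root_.smul_apply, ContinuousLinearMap.comp_apply,
    ContinuousLinearMap.coe_fst', ContinuousLinearMap.coe_snd', ContinuousLinearEquiv.coe_coe,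
    innerSL_apply_apply, smul_eq_mul, nsmul_eq_mul, Function.comp_apply, Nat.cast_ofNat]
  ring

/-! ### The stub -/

/-- **S2a `stub_cutoffTest`** — THE PRODUCT CUT-OFF TEST. For a cylindrical `Φ` (fields `g₁…g_m`,
profile `φ`), an order `K` and a level `ρ > 0` there is a cylindrical test `Ψ` — fields `Φ.g`
followed (`Fin.append`) by the Parseval frame `(Torus.galerkinTest K hρ).g` of `P_K H`, profile
`Π(z) = φ(z_head) · χ(|z_tail|²/ρ)` with `χ = Torus.galerkinCutoff` (head/tail through
`EuclideanSpace.finAddEquivProd`) — whose differential is, for EVERY `v ∈ H`,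
`Ψ'(v) = χ(|P_K v|²/ρ) Φ'(v) + (2/ρ) χ'(|P_K v|²/ρ) Φ(v) P_K v`
(`|P_K v|² = Torus.truncNormSq K v = Σ_p (v, e_p)²` by `Torus.norm_sq_galerkinTest_coords`,
`Σ_p (v, e_p) e_p = P_K v` by `Torus.sum_integral_inner_frameField_smul`; pattern
`Torus.grad_galerkinTest`). [cite: FoiasManleyRosaTemam2001, Ch. IV §1.2 p. 197; App. B.1] -/
theorem stub_cutoffTest (Φ : Torus.CylindricalTest (Fin 3)) (K : ℕ) (ρ : ℝ) (hρ : 0 < ρ) :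
    ∃ Ψ : Torus.CylindricalTest (Fin 3), ∀ v : H3, Ψ.grad v = fun x =>
      (Torus.galerkinCutoff : ℝ → ℝ) (Torus.truncNormSq K v / ρ) • Φ.grad v x +
        (2 / ρ * deriv (Torus.galerkinCutoff : ℝ → ℝ) (Torus.truncNormSq K v / ρ) * Φ.eval v) •
          Torus.fourierTruncate K (((v : L2)) : Vec3) x := by
  set G : Torus.CylindricalTest (Fin 3) := Torus.galerkinTest (d := Fin 3) K hρ with hG
  refine ⟨
    { m := Φ.m + G.m
      g := Fin.append Φ.g G.g
      g_smooth := fun l => by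
        induction l using Fin.addCases with
        | left i => simpa only [Fin.append_left] using Φ.g_smooth i
        | right j => simpa only [Fin.append_right] using G.g_smooth j
      g_divFree := fun l => by
        induction l using Fin.addCases with
        | left i => simpa only [Fin.append_left] using Φ.g_divFree i
        | right j => simpa only [Fin.append_right] using G.g_divFree j
      g_zeroMean := fun l => by
        induction l using Fin.addCases with
        | left i => simpa only [Fin.append_left] using Φ.g_zeroMean i
        | right j => simpa only [Fin.append_right] using G.g_zeroMean j
      φ := fun z => Φ.φ (EuclideanSpace.finAddEquivProd z).1 *
        (Torus.galerkinCutoff : ℝ → ℝ) (‖(EuclideanSpace.finAddEquivProd z).2‖ ^ 2 / ρ)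
      φ_contDiff := cutoffTest_contDiff_profile Φ.φ_contDiff ρ
      φ_compact := cutoffTest_hasCompactSupport_profile Φ.φ_compact hρ }, fun v => ?_⟩
  -- the coordinates of `v` through `Ψ`: head `= Φ.coords v`, tail `= G.coords v`
  set c : EuclideanSpace ℝ (Fin (Φ.m + G.m)) :=
    WithLp.toLp 2 fun l => Torus.pairing (v : L2) (Fin.append Φ.g G.g l) with hc
  have hc1 : (EuclideanSpace.finAddEquivProd c).1 = Φ.coords v := by
    ext i
    simp [hc, Torus.CylindricalTest.coords, Fin.append_left]
  have hc2 : (EuclideanSpace.finAddEquivProd c).2 = G.coords v := by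
    ext j
    simp [hc, Torus.CylindricalTest.coords, Fin.append_right]
  have hnorm : ‖G.coords v‖ ^ 2 = Torus.truncNormSq K v := Torus.norm_sq_galerkinTest_coords K hρ v
  funext x
  -- the frame reproduces the truncation: `Σ_p (v, e_p) e_p x = P_K v x`
  have hsum : ∑ j, G.coords v j • G.g j x = Torus.fourierTruncate K (((v : L2)) : Vec3) x := by
    rw [← Torus.sum_integral_inner_frameField_smul v.2 K x]
    exact Torus.sum_galerkinTest_eq K hρ (fun g => Torus.pairing (v : L2) g • g x)
  change (∑ l : Fin (Φ.m + G.m),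
      fderiv ℝ (fun z : EuclideanSpace ℝ (Fin (Φ.m + G.m)) =>
          Φ.φ (EuclideanSpace.finAddEquivProd z).1 *
            (Torus.galerkinCutoff : ℝ → ℝ) (‖(EuclideanSpace.finAddEquivProd z).2‖ ^ 2 / ρ))
        c (EuclideanSpace.single l 1) • Fin.append Φ.g G.g l x) = _
  rw [Fin.sum_univ_add]
  simp only [Fin.append_left, Fin.append_right, cutoffTest_fderiv_profile Φ.φ_contDiff ρ,
    cutoffTest_split_single_castAdd_fst, cutoffTest_split_single_castAdd_snd,
    cutoffTest_split_single_natAdd_fst, cutoffTest_split_single_natAdd_snd, hc1, hc2, hnorm,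
    inner_zero_right, mul_zero, add_zero, map_zero, zero_mul, zero_add,
    EuclideanSpace.inner_single_right, one_mul, RCLike.conj_to_real]
  rw [show Φ.grad v x = ∑ i, fderiv ℝ Φ.φ (Φ.coords v) (EuclideanSpace.single i 1) • Φ.g i x
      from rfl, ← hsum, Finset.smul_sum, Finset.smul_sum]
  refine congrArg₂ (· + ·) (Finset.sum_congr rfl fun i _ => ?_) (Finset.sum_congr rfl fun j _ => ?_)
  · -- the head block: `χ(|P_K v|²/ρ) ∂ᵢφ gᵢ x`
    rw [smul_smul, mul_comm]
  · -- the tail block: `(2/ρ) χ'(|P_K v|²/ρ) Φ(v) (v, e_j) e_j x`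
    rw [smul_smul]
    refine congrArg (fun r : ℝ => r • G.g j x) ?_
    unfold Torus.CylindricalTest.eval
    ring

end Summit.AnomalousDissipation.AnomalousDissipation.Theorems.TameRoughRigidity.TameClosure
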